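import Summits.NavierStokesRegularity.FluidComputer.LocalisationFace
import Literature.Analysis.FluidPDE.SereginSverak2002CaseB
import HarnessLib

/-!
# Fluid computer — the level dictionary, PRESSURE FACE (L38): the normalised pressure digs below every level in
# every terminal window (Seregin–Šverák 2002)

HONEST FRAMING (cell `pub-fluidc`, verbatim): *low prior, high value-of-information experiment on Tao's
machine paradigm; NOT a claim that NS blows up.* Theorem side of the cell; nothing here is evidence of blow-up.
All faces so far are stated on the velocity. Seregin–Šverák (Arch. Ration. Mech. Anal. 163 (2002), Thm. 2.2, the
case `p ≥ −g` with `g ≡ K` — PROVED in the tree: `SereginSverak2002.isBackwardBoundedAt_of_floor`, whose proof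
(blow-up limits at the vertex vanish weakly under a pressure floor; CKN at the final time forbids the
concentration) does not use the rapid decay of the datum) read contrapositively gives the PRESSURE face of a
realised blow-up. The pressure is the NORMALISED one, `p̃ = R_i R_j (u_i u_j) = normalisedPressure (u t)` (zero at
infinity; the classical pressure differs from it by a function of time only). For every maximal smooth solution
`(u, p)` of the unforced Navier–Stokes system on `ℝ³ × [0, T)` (`ν > 0`) which is Leray–Hopf from `u 0`:

* `exists_normalisedPressure_lt` (**L38 — NO PRESSURE FLOOR**): for every `K` some `(t, x)`, `t ∈ (0, T)`, has
  `p̃(t, x) < −K`;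
* `exists_normalisedPressure_lt_window` (**L38′ — IN EVERY TERMINAL WINDOW**): for every `K` and every `t₀ < T` some
  `t ∈ (t₀, T)` and `x` have `p̃(t, x) < −K` (restart at an a.e.-good time after `t₀`; the singular point of L33′
  is a singular point of the translate) — `limsup_{t↑T} (− inf_x p̃(t, x)) = +∞`;
* `frequently_normalisedPressure_lt` (**L38′ as a `∃ᶠ` statement** along `t ↑ T`).

Reading for the machine paradigm (words): `Δp̃ = ½|ω|² − |S|²`; the wells of `p̃` are the rotation-dominated cores.
A blow-up must dig ARBITRARILY DEEP PRESSURE WELLS in every terminal window — a machine whose (zero-mean /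
normalised) pressure minimum stays bounded is not approaching a singularity. The infimum is global in space (the
criterion is a floor on all of `ℝ³`); no rate is asserted (scaling suggests `−inf p̃ ≳ ν/(T − t)` — NOT proved
here). The companion HEAD alternative of the paper (`|u|²/2 + p̃ ≤ K`) is not used: its final-time hypothesis is
not available for the class (`SereginSverak2002WithFinalEnergy.lean`). Necessity only. 0 sorry; no new definitions,
no named facts.

## References

* G. Seregin, V. Šverák, *Navier–Stokes equations with lower bounds on the pressure*, Arch. Ration. Mech. Anal. 163
  (2002) 65–86: Def. 2.1, Thm. 2.2, Remark 2.3 (p. 70); §4. [SereginSverak2002]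
* L. Caffarelli, R. Kohn, L. Nirenberg, Comm. Pure Appl. Math. 35 (1982) 771–831. [CKN1982]
-/

noncomputable section

open MeasureTheory Set Function Filter Topology Metric
open scoped ENNReal NNReal
open Literature.Analysis.FluidPDE Literature.Analysis.FunctionSpaces
open Summit.NavierStokesRegularity.FluidComputer.LocalisationFace

namespace Summit.NavierStokesRegularity.FluidComputer.PressureFace

/-- **The contradiction at a singular point.** A classical solution on `ℝ³ × [0, T)` (`ν > 0`, `T > 0`),
Leray–Hopf from `u 0`, with a pressure floor `p̃ ≥ −K` on `(0, T) × ℝ³`, has no point at which it is unbounded on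
every backward parabolic neighbourhood of `(T, ·)`: by `SereginSverak2002.isBackwardBoundedAt_of_floor` every
`(T, x₀)` is backward bounded. [cite: SereginSverak2002, Thm. 2.2 (p. 70), case p ≥ −g] -/
theorem not_unbounded_of_floor {ν T : ℝ} (hν : 0 < ν) (hT : 0 < T)
    {u : ℝ → EuclideanSpace ℝ (Fin 3) → EuclideanSpace ℝ (Fin 3)} {p : ℝ → EuclideanSpace ℝ (Fin 3) → ℝ}
    (hcl : IsClassicalNSSolutionOn (Ico 0 T) ν 0 u p) (hLH : IsLerayHopfOn T ν 0 (u 0) u)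
    {K : ℝ} (hfloor : ∀ t ∈ Ioo 0 T, ∀ x, -K ≤ normalisedPressure (u t) x)
    {x₀ : EuclideanSpace ℝ (Fin 3)}
    (hsing : ∀ r : ℝ, 0 < r → ∀ M : ℝ, ∃ t ∈ Ioo (T - r ^ 2) T, 0 < t ∧ ∃ x ∈ ball x₀ r, M < ‖u t x‖) :
    False := by
  obtain ⟨r, hr, C, hC⟩ :=
    SereginSverak2002.isBackwardBoundedAt_of_floor hν hT hcl hLH hfloor ⟨hT, le_rfl⟩ x₀
  obtain ⟨t, ht, -, x, hx, hbig⟩ := hsing r hr C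
  have hle := hC t ht x hx
  linarith

/-- **The focus survives a restart.** If `u` is unbounded on every backward parabolic neighbourhood of `(T, x₀)`
at positive times (the notion of L33′) and `s ∈ [0, T)`, then the translate `u(· + s)` is unbounded on every
backward parabolic neighbourhood of `(T − s, x₀)` at positive times (test `u` on the radius `min r √(T − s)`, whose
times lie after `s`). [folklore] -/
theorem unbounded_translate {T s : ℝ} (hs : s ∈ Ico 0 T)
    {u : ℝ → EuclideanSpace ℝ (Fin 3) → EuclideanSpace ℝ (Fin 3)} {x₀ : EuclideanSpace ℝ (Fin 3)}
    (hsing : ∀ r : ℝ, 0 < r → ∀ M : ℝ, ∃ t ∈ Ioo (T - r ^ 2) T, 0 < t ∧ ∃ x ∈ ball x₀ r, M < ‖u t x‖) :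
    ∀ r : ℝ, 0 < r → ∀ M : ℝ, ∃ t ∈ Ioo (T - s - r ^ 2) (T - s), 0 < t ∧
      ∃ x ∈ ball x₀ r, M < ‖u (t + s) x‖ := by
  intro r hr M
  have hTs : 0 < T - s := sub_pos.2 hs.2
  set r₁ : ℝ := min r (Real.sqrt (T - s)) with hr₁
  have hr₁pos : 0 < r₁ := lt_min hr (Real.sqrt_pos.2 hTs)
  have hr₁r : r₁ ≤ r := min_le_left _ _
  have hr₁T : r₁ ^ 2 ≤ T - s := by
    calc r₁ ^ 2 ≤ (Real.sqrt (T - s)) ^ 2 := pow_le_pow_left₀ hr₁pos.le (min_le_right _ _) 2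
      _ = T - s := Real.sq_sqrt hTs.le
  obtain ⟨t, ht, -, x, hx, hbig⟩ := hsing r₁ hr₁pos M
  have h1 : r₁ ^ 2 ≤ r ^ 2 := pow_le_pow_left₀ hr₁pos.le hr₁r 2
  refine ⟨t - s, ⟨by linarith [ht.1], by linarith [ht.2]⟩, by linarith [ht.1], x, ball_subset_ball hr₁r hx, ?_⟩
  simp only [sub_add_cancel]
  exact hbig

/-! ## L38: no pressure floor -/

/-- **L38 — NO PRESSURE FLOOR.** For `ν > 0`, `T > 0` and every maximal smooth solution `(u, p)` of the unforced
Navier–Stokes system on `ℝ³ × [0, T)` which is Leray–Hopf from `u 0`: for every `K` there are `t ∈ (0, T)` and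
`x` with `normalisedPressure (u t) x < −K` (the singular point of L33′ against Seregin–Šverák's floor theorem).
[cite: SereginSverak2002, Thm. 2.2 (p. 70), case p ≥ −g] -/
theorem exists_normalisedPressure_lt {ν T : ℝ} (hν : 0 < ν) (hT : 0 < T)
    {u : ℝ → EuclideanSpace ℝ (Fin 3) → EuclideanSpace ℝ (Fin 3)} {p : ℝ → EuclideanSpace ℝ (Fin 3) → ℝ}
    (hmax : IsMaximalSmoothSolution ν 0 u p T) (hLH : IsLerayHopfOn T ν 0 (u 0) u) (K : ℝ) :
    ∃ t ∈ Ioo 0 T, ∃ x : EuclideanSpace ℝ (Fin 3), normalisedPressure (u t) x < -K := by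
  obtain ⟨x₀, hsing⟩ := exists_singularPoint hν hT hmax hLH
  by_contra hno
  push Not at hno
  exact not_unbounded_of_floor hν hT hmax.1 hLH hno hsing

/-- **L38′ — NO PRESSURE FLOOR IN ANY TERMINAL WINDOW.** With the same data: for every `K` and every
`t₀ ∈ [0, T)` there are `t ∈ (t₀, T)` and `x` with `normalisedPressure (u t) x < −K`, i.e.
`limsup_{t↑T} (− inf_x p̃(t, x)) = +∞`. Proof: restart at an a.e.-good time `s ∈ (t₀, T)`
(`IsLerayHopfOn.exists_isLerayHopfOn_restart_Ioo`); the translate `u(· + s)` is classical on `[0, T − s)`,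
Leray–Hopf from `u s`, has the floor on `(0, T − s)`, and the singular point `x₀` of L33′ is a point at which it is
unbounded on every backward neighbourhood of `(T − s, x₀)`. [cite: SereginSverak2002, Thm. 2.2 (p. 70), case p ≥ −g] -/
theorem exists_normalisedPressure_lt_window {ν T : ℝ} (hν : 0 < ν) (hT : 0 < T)
    {u : ℝ → EuclideanSpace ℝ (Fin 3) → EuclideanSpace ℝ (Fin 3)} {p : ℝ → EuclideanSpace ℝ (Fin 3) → ℝ}
    (hmax : IsMaximalSmoothSolution ν 0 u p T) (hLH : IsLerayHopfOn T ν 0 (u 0) u) (K : ℝ)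
    {t₀ : ℝ} (ht₀ : t₀ ∈ Ico 0 T) :
    ∃ t ∈ Ioo t₀ T, ∃ x : EuclideanSpace ℝ (Fin 3), normalisedPressure (u t) x < -K := by
  obtain ⟨x₀, hsing⟩ := exists_singularPoint hν hT hmax hLH
  by_contra hno
  push Not at hno
  -- an a.e.-good restart time `s ∈ (t₀, T)`
  obtain ⟨s, hs, hLHs⟩ := hLH.exists_isLerayHopfOn_restart_Ioo hν.le ht₀.1 ht₀.2 le_rfl
  have hs0 : 0 < s := ht₀.1.trans_lt hs.1
  have hTs : 0 < T - s := sub_pos.2 hs.2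
  -- the translate
  have hcl' : IsClassicalNSSolutionOn (Ico 0 (T - s)) ν 0 (fun t => u (t + s)) (fun t => p (t + s)) :=
    hmax.1.translate_Ico_zero hs0.le
  have hLH' : IsLerayHopfOn (T - s) ν 0 ((fun t => u (t + s)) 0) (fun t => u (t + s)) := by
    show IsLerayHopfOn (T - s) ν 0 (u (0 + s)) (fun t => u (t + s))
    rw [zero_add]
    exact hLHs
  have hfloor' : ∀ t ∈ Ioo 0 (T - s), ∀ x, -K ≤ normalisedPressure ((fun t => u (t + s)) t) x :=
    fun t ht x => hno (t + s) ⟨by linarith [ht.1, hs.1], by linarith [ht.2]⟩ x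
  have hsing' := unbounded_translate ⟨hs0.le, hs.2⟩ hsing
  exact not_unbounded_of_floor hν hTs hcl' hLH' hfloor' hsing'

/-- **L38′ along `t ↑ T`**: for every `K`, frequently as `t ↑ T` some `x` has `normalisedPressure (u t) x < −K`.
[cite: SereginSverak2002, Thm. 2.2 (p. 70), case p ≥ −g] -/
theorem frequently_normalisedPressure_lt {ν T : ℝ} (hν : 0 < ν) (hT : 0 < T)
    {u : ℝ → EuclideanSpace ℝ (Fin 3) → EuclideanSpace ℝ (Fin 3)} {p : ℝ → EuclideanSpace ℝ (Fin 3) → ℝ}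
    (hmax : IsMaximalSmoothSolution ν 0 u p T) (hLH : IsLerayHopfOn T ν 0 (u 0) u) (K : ℝ) :
    ∃ᶠ t in 𝓝[<] T, ∃ x : EuclideanSpace ℝ (Fin 3), normalisedPressure (u t) x < -K := by
  rw [(nhdsLT_basis T).frequently_iff]
  intro a ha
  obtain ⟨t, ht, x, hx⟩ := exists_normalisedPressure_lt_window hν hT hmax hLH K
    (t₀ := max a 0) ⟨le_max_right _ _, max_lt ha hT⟩
  exact ⟨t, ⟨(le_max_left _ _).trans_lt ht.1, ht.2⟩, x, hx⟩

/-- **THE PRESSURE FACE, ASSEMBLED**: for every `K` and every `t₀ ∈ [0, T)` the normalised pressure takes a value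
below `−K` at some `(t, x)` with `t ∈ (t₀, T)` — no pressure floor in any terminal window.
[cite: SereginSverak2002, Thm. 2.2 (p. 70), case p ≥ −g] -/
theorem pressure_face {ν T : ℝ} (hν : 0 < ν) (hT : 0 < T)
    {u : ℝ → EuclideanSpace ℝ (Fin 3) → EuclideanSpace ℝ (Fin 3)} {p : ℝ → EuclideanSpace ℝ (Fin 3) → ℝ}
    (hmax : IsMaximalSmoothSolution ν 0 u p T) (hLH : IsLerayHopfOn T ν 0 (u 0) u) :
    ∀ K : ℝ, ∀ t₀ ∈ Ico 0 T, ∃ t ∈ Ioo t₀ T, ∃ x : EuclideanSpace ℝ (Fin 3),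
      normalisedPressure (u t) x < -K :=
  fun K _ ht₀ => exists_normalisedPressure_lt_window hν hT hmax hLH K ht₀

end Summit.NavierStokesRegularity.FluidComputer.PressureFace

end
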